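import Summits.PneNP.PneNP.Theorems.SliceACZero.Negative.DeltaBeforeK

/-!
# `SliceACZero` (stmt-PneNP-2835) — negative-side lemmas IV: how deep may the window reach?

`not_innerConcLowWindow`: moving the lower edge of the window of `Conc` from `m - m^{3/4}` down to
`m · n^{-ε}` (any fixed `ε > 0`) makes the inner clause FALSE for every `δ > 0` (`d ≥ 1`, every `c`,
`k ≥ 3`): on the slice `j = ⌈m n^{-ε}⌉₊` at most a `(2n^{-ε})^{C(k,2)}/k!`-fraction of the graphs carries
a `k`-clique (`firstMoment_slice'`, `choose_mul_ratio_pow_le'`), so the constant-`0` circuit is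
`δ`-accurate. Hence the admissible windows are `m · n^{±o(1)}`; the route's `m ± m^{3/4}` sits inside
(and the intended slice-to-binomial transfer needs `±√j·log j` room around every central `j`). The
symmetric statement for the upper edge (`j = m · n^{ε}`, constant-`1` circuit) needs
`Pr_j[no k-clique] → 0` on the slice (second moment) and is not attempted.

Refuter seat cdisprove-stmt-PneNP-2835 (gen 1), 2026-08-16. In the docstrings, `InnerConc d c k δ` /
`InnerHyp d c k δ` (and their `NoWindow`/`NoBasis`/… variants) denote the displayed inner clauses; they are
named predicates only in the work file `Summits/PneNP/PneNP/Cruxes/SliceACZero/Disproof.lean` (running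
commentary: why the crux resists, what was not attempted) and are INLINED here.
-/

noncomputable section

namespace Summit.PneNP.PneNP.Theorems.SliceACZero.Negative

open Literature.Computability.Complexity Filter Finset
open Summit.PneNP.PneNP.Theses.OneSlice (SliceACZero)

/-! ## Part V — how far down may the window reach? Not to `m · n^{-ε}` (subcritical slices)

A quantitative tightness statement about the WINDOW: if the lower edge of the window is moved from
`m - m^{3/4}` down to `m · n^{-ε}` for any fixed `ε > 0`, the inner clause of `Conc` becomes FALSE
(`d ≥ 1`, every `c`, `k ≥ 3`, every `δ > 0`): on the slice `j = ⌈m n^{-ε}⌉₊` the first moment gives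
`Pr_j[k-clique] ≤ (2 n^{-ε})^{C(k,2)}/k! → 0`, so the constant-`0` circuit is `δ`-accurate
(`not_innerConcLowWindow`). Hence the admissible windows are `m · n^{±o(1)}`; the route's `m ± m^{3/4}`
sits safely inside (and must: the intended transfer needs `±√j·log j` room around every central `j`).
The symmetric statement for the UPPER edge (`j = m · n^{ε}`, constant-`1` circuit) needs
`Pr_j[no k-clique] → 0`, a second-moment/Janson bound on the slice — not attempted. -/

section LowWindow

variable {n : ℕ}

/-- **Threshold arithmetic with a density factor `t`**: if `j ≤ C(n,2) · n^{-2/(k-1)} · t` then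
`C(n,k) · (j/C(n,2))^{C(k,2)} ≤ t^{C(k,2)}/k!`. [folklore] -/
theorem choose_mul_ratio_pow_le' {n k j : ℕ} (hk : 2 ≤ k) (hn : 1 ≤ n) (hN : 0 < n.choose 2)
    {t : ℝ} (hjm : (j : ℝ) ≤ (n.choose 2 : ℕ) * (n : ℝ) ^ (-(2 : ℝ) / ((k : ℝ) - 1)) * t) :
    (n.choose k : ℝ) * ((j : ℝ) / (n.choose 2 : ℕ)) ^ (k.choose 2) ≤
      t ^ (k.choose 2) / (k.factorial : ℝ) := by
  have hNr : (0 : ℝ) < (n.choose 2 : ℕ) := by exact_mod_cast hN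
  have hn0 : (0 : ℝ) ≤ n := Nat.cast_nonneg _
  have hnpos : (0 : ℝ) < n := by exact_mod_cast hn
  have ha0 : 0 ≤ (n : ℝ) ^ (-(2 : ℝ) / ((k : ℝ) - 1)) := Real.rpow_nonneg hn0 _
  have hratio : (j : ℝ) / (n.choose 2 : ℕ) ≤ (n : ℝ) ^ (-(2 : ℝ) / ((k : ℝ) - 1)) * t := by
    rw [div_le_iff₀ hNr]
    calc (j : ℝ) ≤ (n.choose 2 : ℕ) * (n : ℝ) ^ (-(2 : ℝ) / ((k : ℝ) - 1)) * t := hjm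
      _ = (n : ℝ) ^ (-(2 : ℝ) / ((k : ℝ) - 1)) * t * (n.choose 2 : ℕ) := by ring
  have hratio0 : 0 ≤ (j : ℝ) / (n.choose 2 : ℕ) := div_nonneg (Nat.cast_nonneg _) hNr.le
  have hpow : ((j : ℝ) / (n.choose 2 : ℕ)) ^ (k.choose 2) ≤
      ((n : ℝ) ^ (-(2 : ℝ) / ((k : ℝ) - 1)) * t) ^ (k.choose 2) :=
    pow_le_pow_left₀ hratio0 hratio _
  have hexp : ((n : ℝ) ^ (-(2 : ℝ) / ((k : ℝ) - 1))) ^ (k.choose 2) = ((n : ℝ) ^ k)⁻¹ := by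
    rw [← Real.rpow_mul_natCast hn0, Nat.cast_choose_two]
    have hk1 : (k : ℝ) - 1 ≠ 0 := by
      have : (2 : ℝ) ≤ k := by exact_mod_cast hk
      linarith
    have : -(2 : ℝ) / ((k : ℝ) - 1) * ((k : ℝ) * ((k : ℝ) - 1) / 2) = -(k : ℝ) := by
      field_simp
    rw [this, Real.rpow_neg hn0, Real.rpow_natCast]
  have hchoose : (n.choose k : ℝ) ≤ (n : ℝ) ^ k / (k.factorial : ℝ) := by
    have := Nat.choose_le_pow_div k n (α := ℝ)
    simpa using this
  have hnk : (0 : ℝ) < (n : ℝ) ^ k := pow_pos hnpos k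
  calc (n.choose k : ℝ) * ((j : ℝ) / (n.choose 2 : ℕ)) ^ (k.choose 2)
      ≤ ((n : ℝ) ^ k / k.factorial) * (((n : ℝ) ^ k)⁻¹ * t ^ (k.choose 2)) := by
        rw [← hexp, ← mul_pow]
        exact mul_le_mul hchoose hpow (pow_nonneg hratio0 _)
          (div_nonneg (pow_nonneg hn0 _) (Nat.cast_nonneg _))
    _ = t ^ (k.choose 2) / k.factorial := by
        field_simp

/-- **First moment on a slice below the threshold**: if `C(k,2) ≤ j ≤ C(n,2)` and
`j ≤ C(n,2) · n^{-2/(k-1)} · t`, at most a `t^{C(k,2)}/k!`-fraction of the graphs with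
exactly `j` edges have a `k`-clique. [folklore] -/
theorem firstMoment_slice' {k j : ℕ} (hk : 2 ≤ k) (hn : 1 ≤ n) (hKj : k.choose 2 ≤ j)
    (hjN : j ≤ n.choose 2) {t : ℝ}
    (hjm : (j : ℝ) ≤ (n.choose 2 : ℕ) * (n : ℝ) ^ (-(2 : ℝ) / ((k : ℝ) - 1)) * t) :
    (#(univ.filter fun x : (⊤ : SimpleGraph (Fin n)).edgeSet → Bool =>
        edgeCount x = j ∧ cliqueFn n k x = true) : ℝ) ≤
      t ^ (k.choose 2) / (k.factorial : ℝ) * sliceCard n j := by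
  have hK1 : 0 < k.choose 2 := Nat.choose_pos hk
  have hN : 0 < n.choose 2 := by omega
  have hNr : (0 : ℝ) < (n.choose 2 : ℕ) := by exact_mod_cast hN
  have hcomb := card_slice_clique_le (n := n) j k hKj
  have hratio := choose_sub_mul_pow_le_choose_mul_pow (K := k.choose 2) hKj hjN
  have hratio' : (((n.choose 2 - k.choose 2).choose (j - k.choose 2) : ℕ) : ℝ) ≤
      ((n.choose 2).choose j : ℕ) * ((j : ℝ) / (n.choose 2 : ℕ)) ^ (k.choose 2) := by
    rw [div_pow, ← mul_div_assoc, le_div_iff₀ (pow_pos hNr _)]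
    exact_mod_cast hratio
  calc (#(univ.filter fun x : (⊤ : SimpleGraph (Fin n)).edgeSet → Bool =>
          edgeCount x = j ∧ cliqueFn n k x = true) : ℝ)
      ≤ (n.choose k : ℝ) * (((n.choose 2 - k.choose 2).choose (j - k.choose 2) : ℕ) : ℝ) := by
        exact_mod_cast hcomb
    _ ≤ (n.choose k : ℝ) * (((n.choose 2).choose j : ℕ) * ((j : ℝ) / (n.choose 2 : ℕ)) ^ (k.choose 2)) :=
        mul_le_mul_of_nonneg_left hratio' (Nat.cast_nonneg _)
    _ = ((n.choose k : ℝ) * ((j : ℝ) / (n.choose 2 : ℕ)) ^ (k.choose 2)) *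
          ((n.choose 2).choose j : ℕ) := by ring
    _ ≤ t ^ (k.choose 2) / (k.factorial : ℝ) * ((n.choose 2).choose j : ℕ) :=
        mul_le_mul_of_nonneg_right (choose_mul_ratio_pow_le' hk hn hN hjm) (Nat.cast_nonneg _)
    _ = t ^ (k.choose 2) / (k.factorial : ℝ) * sliceCard n j := by rw [sliceCard_eq]

/-- **The window cannot reach the subcritical slices `j ≈ m · n^{-ε}`** (`d ≥ 1`, every `c`, `k ≥ 3`,
every `δ > 0`, `ε > 0`): there `Pr_j[k-clique] ≤ (2n^{-ε})^{C(k,2)}/k! ≤ 2 n^{-ε} ≤ δ` eventually, so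
the constant-`0` circuit (size `1`) is `δ`-accurate and `n ^ c < 1` fails. [folklore] -/
theorem not_innerConcLowWindow {d : ℕ} (hd : 1 ≤ d) (c : ℕ) {k : ℕ} (hk : 3 ≤ k) {δ ε : ℝ}
    (hδ : 0 < δ) (hε : 0 < ε) : ¬ (∀ᶠ n : ℕ in atTop, ∀ j : ℕ, (mk n k : ℝ) * (n : ℝ) ^ (-ε) ≤ j → j ≤ mk n k →
        ∀ C : Circuit ((⊤ : SimpleGraph (Fin n)).edgeSet), C.IsOver acBasis → C.acDepth ≤ d →
          (sliceErr n j C.eval (cliqueFn n k) : ℝ) ≤ δ * sliceCard n j → n ^ c < C.size) := by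
  intro h
  -- eventually n^{-ε} ≤ min (1/2) (δ/2)
  have hsmall : ∀ᶠ n : ℕ in atTop, (n : ℝ) ^ (-ε) < min (1 / 2) (δ / 2) :=
    ((tendsto_rpow_neg_atTop hε).comp tendsto_natCast_atTop_atTop).eventually
      (gt_mem_nhds (lt_min (by norm_num) (by linarith)))
  obtain ⟨n, hn, hn1, hsm⟩ := (h.and ((eventually_ge_atTop 1).and hsmall)).exists
  have hk2 : 2 ≤ k := by omega
  have hn0 : (0 : ℝ) ≤ n := Nat.cast_nonneg _
  have hnε0 : 0 ≤ (n : ℝ) ^ (-ε) := Real.rpow_nonneg hn0 _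
  have hnε1 : (n : ℝ) ^ (-ε) ≤ 1 :=
    Real.rpow_le_one_of_one_le_of_nonpos (by exact_mod_cast hn1) (by linarith)
  have hhalf : (n : ℝ) ^ (-ε) < 1 / 2 := hsm.trans_le (min_le_left _ _)
  have hdel : (n : ℝ) ^ (-ε) < δ / 2 := hsm.trans_le (min_le_right _ _)
  set x : ℝ := (mk n k : ℝ) * (n : ℝ) ^ (-ε) with hx
  have hx0 : 0 ≤ x := mul_nonneg (Nat.cast_nonneg _) hnε0
  set j : ℕ := ⌈x⌉₊ with hj
  have hjlow : x ≤ j := Nat.le_ceil x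
  have hjup : j ≤ mk n k := by
    refine Nat.ceil_le.2 ?_
    calc x ≤ (mk n k : ℝ) * 1 := mul_le_mul_of_nonneg_left hnε1 (Nat.cast_nonneg _)
      _ = (mk n k : ℕ) := by rw [mul_one]
  -- the constant-0 circuit is δ-accurate on slice j
  have herr : (sliceErr n j (Circuit.const _ false).eval (cliqueFn n k) : ℝ) ≤ δ * sliceCard n j := by
    rw [sliceErr_const_false]
    by_cases hKj : k.choose 2 ≤ j
    · -- here x ≥ j - 1 ≥ K - 1 ≥ 2, so j ≤ x + 1 ≤ 2x
      have hK3 : 3 ≤ k.choose 2 := by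
        have := Nat.choose_le_choose 2 hk
        simpa using this
      have hx1 : 1 ≤ x := by
        have : (j : ℝ) < x + 1 := Nat.ceil_lt_add_one hx0
        have hj3 : (3 : ℝ) ≤ j := by exact_mod_cast hK3.trans hKj
        linarith
      have hj2x : (j : ℝ) ≤ 2 * x := by
        have : (j : ℝ) < x + 1 := Nat.ceil_lt_add_one hx0
        linarith
      have hmk : (mk n k : ℝ) ≤ (n.choose 2 : ℕ) * (n : ℝ) ^ (-(2 : ℝ) / ((k : ℝ) - 1)) :=
        Nat.floor_le (by positivity)
      have hjm : (j : ℝ) ≤ (n.choose 2 : ℕ) * (n : ℝ) ^ (-(2 : ℝ) / ((k : ℝ) - 1)) *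
          (2 * (n : ℝ) ^ (-ε)) := by
        calc (j : ℝ) ≤ 2 * x := hj2x
          _ = (mk n k : ℝ) * (2 * (n : ℝ) ^ (-ε)) := by rw [hx]; ring
          _ ≤ _ := mul_le_mul_of_nonneg_right hmk (by positivity)
      have hfm := firstMoment_slice' hk2 hn1 hKj (hjup.trans (mk_le_choose hn1 hk2)) hjm
      refine hfm.trans (mul_le_mul_of_nonneg_right ?_ (Nat.cast_nonneg _))
      -- (2 n^{-ε})^K / k! ≤ 2 n^{-ε} ≤ δ
      have hb0 : 0 ≤ 2 * (n : ℝ) ^ (-ε) := by positivity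
      have hb1 : 2 * (n : ℝ) ^ (-ε) ≤ 1 := by linarith
      have hK1 : 1 ≤ k.choose 2 := by omega
      have hfac : (1 : ℝ) ≤ k.factorial := by exact_mod_cast Nat.one_le_iff_ne_zero.2 (Nat.factorial_ne_zero k)
      calc (2 * (n : ℝ) ^ (-ε)) ^ (k.choose 2) / (k.factorial : ℝ)
          ≤ (2 * (n : ℝ) ^ (-ε)) ^ (k.choose 2) := div_le_self (pow_nonneg hb0 _) hfac
        _ ≤ (2 * (n : ℝ) ^ (-ε)) ^ 1 := pow_le_pow_of_le_one hb0 hb1 hK1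
        _ ≤ δ := by rw [pow_one]; linarith
    · have h0 : #(univ.filter fun x : (⊤ : SimpleGraph (Fin n)).edgeSet → Bool =>
          edgeCount x = j ∧ cliqueFn n k x = true) = 0 := by
        rw [Finset.card_eq_zero, Finset.filter_eq_empty_iff]
        rintro y - ⟨hyj, hcl⟩
        exact hKj (hyj ▸ choose_le_edgeCount_of_cliqueFn hcl)
      rw [h0, Nat.cast_zero]
      exact mul_nonneg hδ.le (Nat.cast_nonneg _)
  have hlt := hn j (by rw [hj]; exact hjlow) hjup (Circuit.const _ false)
    (Circuit.const_isOver_acBasis false) (by rw [Circuit.acDepth_const]; exact hd) herr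
  rw [Circuit.size_const] at hlt
  exact absurd (Nat.one_le_pow c n hn1) (not_le.2 hlt)

end LowWindow

end Summit.PneNP.PneNP.Theorems.SliceACZero.Negative

end
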